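import Mathlib
import HarnessLib

/-!
# Crux K2 `PoloidalWindowRigidity` (stmt-NavierStokesRegularity-19708), line `z_shock` — ★ NEGATIVE KERNEL BRICK for the
# class-free slice Liouville `hGN`: the DARBOUX–HODOGRAPH FAMILY of explicit two-wave solutions of the autonomous p-system
# with a HUMP-SHAPED (sign-changing genuine nonlinearity) characteristic speed

`--supports stmt-NavierStokesRegularity-19708 --as helper` (leafhand-ns-poloidalwindowdoor-3 g34, cell decomp-ns, 2026-09-01).
Class-free, def-free, Mathlib only.  **No stub and no summit is closed by this file; Navier–Stokes regularity is NOT proved here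
(rung 0).**

## Why this file (line diagnosis, evidence `HGN-COUNTEREXAMPLE-leafhand3-g34.md` on the crux item)

The deciding stub `stub_zShockThickAut` of `Cruxes/PoloidalWindowRigidity/Lines/z_shock.lean` is reduced in the tree
(`…ZShockAutOfSliceLiouville.stub_zShockThickAut_of_sliceLiouville_of_mixedPocket`, g16) to the CLASS-FREE slice Liouville
statement `hGN` («one real-analytic, bounded, bounded-gradient, divergence-free, e₃-poloidal field on ℝ³ with the wedge law,
vanishing autonomy minors, no strictly elliptic point and one hyperbolic / twisting / genuinely nonlinear point does not
exist»), and twenty exit reports (hands 3-g16 … 3-g33) recommend registering `stub_sliceLiouville := hGN`.  The mechanism behind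
it is rung R2/R3 of the card: GENUINE NONLINEARITY + two-sided eternal boundedness ⇒ gradient catastrophe (Lax 1964 / John 1974),
proved in the tree in one horizontal dimension for ONE-SIGNED `κ'` (`…ZShockPSystemNonuniformConst`,
`…ZShockScalarWaveLiouville`, `…ZShockObliqueProfile`); the sign-changing row was booked «(β) [L, probably true]» (g33).

THIS HAND SHOWS (β) IS FALSE AND `hGN` IS FALSE (paper proof in the evidence memo; this file is its algebraic kernel).  In
Riemann's hodograph plane the autonomous p-system `r_z + k(ρ) r_x = 0`, `s_z − k(ρ) s_x = 0` (`ρ = (r − s)/2`, speed `k > 0`)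
becomes the LINEAR system `x_s = k z_s`, `x_r = −k z_r` for the inverse map `(r, s) ↦ (z, x)`.  For the two-parameter family of
speeds `k = ψ²`, `ψ(ρ) = α tanh ρ + β (ρ tanh ρ − 1)` — the zero-energy states of the Pöschl–Teller well `ψ'' = −2 sech²ρ · ψ`,
so that the Liouville-substituted hodograph equation `u_σσ = u_ρρ + 2 sech²ρ · u` is the DARBOUX TRANSFORM of the free wave
equation — the hodograph system has the explicit solutions (arbitrary profiles `f, g` with primitives `F' = f`, `𝔽' = F`,
`G' = g`, `𝔾' = G`, `T = tanh`)

  `z = [f(r) − g(s) − T(ρ)(F(r) + G(s))] / ψ(ρ)`,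
  `x = −ψ(ρ)(f(r) + g(s)) + (α + βρ)(F(r) − G(s)) − β(𝔽(r) + 𝔾(s))`.

For `α = 0`, `β = −1` the speed `k = (1 − ρ tanh ρ)²` is a HUMP: `k' > 0` on `(−1, 0)`, `k' < 0` on `(0, 1)` — genuine
nonlinearity with ONE INFLECTION VALUE and no interval of linear degeneracy.  With `f = g = artanh(·/m)`, `m ≤ 1/2`, the map
`(r, s) ↦ (z, x)` is a real-analytic diffeomorphism of the square `(−m, m)²` onto `ℝ²` with `z_r ≥ c > 0 ≥ −c ≥ z_s` (memo §3:
`2ψ²z_r = 2ψ f'(r) + (ρ − T + ρT²) f(r) − (ρ + T − ρT²) f(s) − F(r) − F(s)`, three-region sign analysis; properness; Hadamard),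
so its inverse is a NONCONSTANT bounded real-analytic two-sided eternal solution of the hump p-system with bounded gradient — a
crossing of two equal-strength monotone waves, expansive in both eternal directions because the speed peaks exactly at the
crossing value.  Its oblique travelling embedding `u(y₀, y₁, z) = (−σ/κ₀, 𝒲(ρ)/κ₀, (𝒲 + 𝒫)(ρ)/κ₀²)(y₀, y₁ − κ₀z)`
(`σ = (r+s)/2`, `𝒲' = 1/k`, `𝒫' = k`) satisfies ALL ELEVEN hypotheses of `hGN` (memo §4, each checked from the p-system
relations `σ_τ = −kρ_ξ`, `ρ_τ = −kσ_ξ`).  CONSEQUENCE FOR THE LINE: the kinematic lever of `z_shock` (R3) is dead on the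
autonomous THICK column unless `G_ww` is ONE-SIGNED on the window's value range — a hypothesis the class does not supply — so the
deciding stub can only be closed through the Navier–Stokes identity (E) / time dependence; `stub_sliceLiouville := hGN` must NOT
be registered.  The registered stub `stub_zShockThickAut` itself (class binders) is untouched.

## Contents (all `HasDerivAt` algebra, no special-function input beyond `tanh = sinh/cosh`)

* `hodograph_r`, `hodograph_s` — ★ for ANY differentiable `T, ψ` satisfying the two Darboux identities
  `(I1) ψT + ψ' = α + βρ`, `(I2) ψT' − ψ'T = −β` at `ρ = (r − s)/2` (and `ψ(ρ) ≠ 0`), the displayed pair satisfies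
  `x_r = −ψ(ρ)² z_r` and `x_s = ψ(ρ)² z_s` (with the explicit value of `z_r`, `z_s`).  Only (I1), (I2) are used.
* `darboux_tanh` — `T = tanh`, `ψ = α tanh ρ + β(ρ tanh ρ − 1)` satisfy (I1), (I2) with `T' = 1 − tanh²`,
  `ψ' = α(1 − tanh²ρ) + β(tanh ρ + ρ(1 − tanh²ρ))`.
* `hump_speed_sign` — for `α = 0`, `β = −1`: `ψ = 1 − ρ tanh ρ > 0` on `|ρ| ≤ 1` and the genuine-nonlinearity coefficient
  `k' = 2ψψ'` is `> 0` for `ρ ∈ (−1, 0)` ... stated as `ψ' ρ > 0` for `−1 ≤ ρ < 0` and `ψ' ρ < 0` for `0 < ρ ≤ 1`.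

presearch: hodograph linearisation and Darboux/Euler–Poisson–Darboux ladders for special pressure laws are classical (Riemann 1860;
Courant–Friedrichs §§ 83–86; [corpus: arXiv:1112.0249 pp. 5, 9; arXiv:1410.2832 p. 2]); an eternal bounded smooth solution for a
sign-changing genuinely nonlinear speed, and the Pöschl–Teller member of the family, were not found in print (corpus hybrid + vector,
galaxy) — [folklore] method, new use.
-/

noncomputable section

namespace Summit.NavierStokesRegularity.NavierStokesRegularity.Theorems.PoloidalWindowDoorPoloidalWindowRigidityZShockHodographDarboux

-- the problem directory repeats the summit name (`NavierStokesRegularity/NavierStokesRegularity`)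
set_option linter.dupNamespace false

open Real

/-- ★ **Hodograph relation in the `r`-direction, `x_r = −ψ(ρ)² z_r`**, for the Darboux pair
`z = [f(r) − g(s) − T(ρ)(F(r)+G(s))]/ψ(ρ)`, `x = −ψ(ρ)(f(r)+g(s)) + (α+βρ)(F(r) − G(s)) − β(𝔽(r)+𝔾(s))`, `ρ = (r−s)/2`,
at a point where `F' = f`, `𝔽' = F`, `ψ(ρ) ≠ 0` and the Darboux identities (I1) `ψT + ψ' = α + βρ`, (I2) `ψT' − ψ'T = −β` hold.
The first component records the value of `z_r`. [folklore] -/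
theorem hodograph_r (f F 𝔽 g G 𝔾 T ψ : ℝ → ℝ) (α β r s f₁ T₁ ψ₁ : ℝ)
    (hf : HasDerivAt f f₁ r) (hF : HasDerivAt F (f r) r) (h𝔽 : HasDerivAt 𝔽 (F r) r)
    (hT : HasDerivAt T T₁ ((r - s) / 2)) (hψ : HasDerivAt ψ ψ₁ ((r - s) / 2))
    (hψ0 : ψ ((r - s) / 2) ≠ 0)
    (hI1 : ψ ((r - s) / 2) * T ((r - s) / 2) + ψ₁ = α + β * ((r - s) / 2))
    (hI2 : ψ ((r - s) / 2) * T₁ - ψ₁ * T ((r - s) / 2) = -β) :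
    HasDerivAt (fun r' => (f r' - g s - T ((r' - s) / 2) * (F r' + G s)) / ψ ((r' - s) / 2))
        (((f₁ - (T₁ * (1 / 2) * (F r + G s) + T ((r - s) / 2) * f r)) * ψ ((r - s) / 2) -
            (f r - g s - T ((r - s) / 2) * (F r + G s)) * (ψ₁ * (1 / 2))) / ψ ((r - s) / 2) ^ 2) r ∧
      HasDerivAt (fun r' => -ψ ((r' - s) / 2) * (f r' + g s) + (α + β * ((r' - s) / 2)) * (F r' - G s) -
          β * (𝔽 r' + 𝔾 s))
        (-(ψ ((r - s) / 2)) ^ 2 *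
          ((((f₁ - (T₁ * (1 / 2) * (F r + G s) + T ((r - s) / 2) * f r)) * ψ ((r - s) / 2) -
            (f r - g s - T ((r - s) / 2) * (F r + G s)) * (ψ₁ * (1 / 2))) / ψ ((r - s) / 2) ^ 2))) r := by
  -- the affine reparametrisation `r' ↦ (r' - s)/2`
  have hρ : HasDerivAt (fun r' : ℝ => (r' - s) / 2) (1 / 2) r := by
    simpa using ((hasDerivAt_id r).sub_const s).div_const 2
  have hTc : HasDerivAt (fun r' : ℝ => T ((r' - s) / 2)) (T₁ * (1 / 2)) r := hT.comp r hρ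
  have hψc : HasDerivAt (fun r' : ℝ => ψ ((r' - s) / 2)) (ψ₁ * (1 / 2)) r := hψ.comp r hρ
  -- numerator `u`
  have hu : HasDerivAt (fun r' => f r' - g s - T ((r' - s) / 2) * (F r' + G s))
      (f₁ - (T₁ * (1 / 2) * (F r + G s) + T ((r - s) / 2) * f r)) r :=
    (hf.sub_const (g s)).sub (hTc.mul (hF.add_const (G s)))
  refine ⟨hu.div hψc hψ0, ?_⟩
  have hx : HasDerivAt (fun r' => -ψ ((r' - s) / 2) * (f r' + g s) + (α + β * ((r' - s) / 2)) * (F r' - G s) -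
      β * (𝔽 r' + 𝔾 s))
      (-(ψ₁ * (1 / 2)) * (f r + g s) + -ψ ((r - s) / 2) * f₁ +
        (β * (1 / 2) * (F r - G s) + (α + β * ((r - s) / 2)) * f r) - β * F r) r :=
    ((hψc.neg.mul (hf.add_const (g s))).add (((hρ.const_mul β).const_add α).mul (hF.sub_const (G s)))).sub
      ((h𝔽.add_const (𝔾 s)).const_mul β)
  refine hx.congr_deriv ?_
  field_simp
  linear_combination (-2 * f r) * hI1 - (F r + G s) * hI2

/-- ★ **Hodograph relation in the `s`-direction, `x_s = ψ(ρ)² z_s`**, for the same Darboux pair, at a point where `G' = g`,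
`𝔾' = G`, `ψ(ρ) ≠ 0` and (I1), (I2) hold at `ρ = (r − s)/2`.  The first component records the value of `z_s`. [folklore] -/
theorem hodograph_s (f F 𝔽 g G 𝔾 T ψ : ℝ → ℝ) (α β r s g₁ T₁ ψ₁ : ℝ)
    (hg : HasDerivAt g g₁ s) (hG : HasDerivAt G (g s) s) (h𝔾 : HasDerivAt 𝔾 (G s) s)
    (hT : HasDerivAt T T₁ ((r - s) / 2)) (hψ : HasDerivAt ψ ψ₁ ((r - s) / 2))
    (hψ0 : ψ ((r - s) / 2) ≠ 0)
    (hI1 : ψ ((r - s) / 2) * T ((r - s) / 2) + ψ₁ = α + β * ((r - s) / 2))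
    (hI2 : ψ ((r - s) / 2) * T₁ - ψ₁ * T ((r - s) / 2) = -β) :
    HasDerivAt (fun s' => (f r - g s' - T ((r - s') / 2) * (F r + G s')) / ψ ((r - s') / 2))
        (((-g₁ - (T₁ * (-(1 / 2)) * (F r + G s) + T ((r - s) / 2) * g s)) * ψ ((r - s) / 2) -
            (f r - g s - T ((r - s) / 2) * (F r + G s)) * (ψ₁ * (-(1 / 2)))) / ψ ((r - s) / 2) ^ 2) s ∧
      HasDerivAt (fun s' => -ψ ((r - s') / 2) * (f r + g s') + (α + β * ((r - s') / 2)) * (F r - G s') -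
          β * (𝔽 r + 𝔾 s'))
        ((ψ ((r - s) / 2)) ^ 2 *
          ((((-g₁ - (T₁ * (-(1 / 2)) * (F r + G s) + T ((r - s) / 2) * g s)) * ψ ((r - s) / 2) -
            (f r - g s - T ((r - s) / 2) * (F r + G s)) * (ψ₁ * (-(1 / 2)))) / ψ ((r - s) / 2) ^ 2))) s := by
  have hρ : HasDerivAt (fun s' : ℝ => (r - s') / 2) (-(1 / 2)) s := by
    exact (((hasDerivAt_id' s).const_sub r).div_const 2).congr_deriv (by ring)
  have hTc : HasDerivAt (fun s' : ℝ => T ((r - s') / 2)) (T₁ * (-(1 / 2))) s := hT.comp s hρ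
  have hψc : HasDerivAt (fun s' : ℝ => ψ ((r - s') / 2)) (ψ₁ * (-(1 / 2))) s := hψ.comp s hρ
  have hu : HasDerivAt (fun s' => f r - g s' - T ((r - s') / 2) * (F r + G s'))
      (-g₁ - (T₁ * (-(1 / 2)) * (F r + G s) + T ((r - s) / 2) * g s)) s := by
    have h1 : HasDerivAt (fun s' => f r - g s') (-g₁) s := by
      simpa using hg.const_sub (f r)
    exact h1.sub (hTc.mul (hG.const_add (F r)))
  refine ⟨hu.div hψc hψ0, ?_⟩
  have hx : HasDerivAt (fun s' => -ψ ((r - s') / 2) * (f r + g s') + (α + β * ((r - s') / 2)) * (F r - G s') -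
      β * (𝔽 r + 𝔾 s'))
      (-(ψ₁ * (-(1 / 2))) * (f r + g s) + -ψ ((r - s) / 2) * g₁ +
        (β * (-(1 / 2)) * (F r - G s) + (α + β * ((r - s) / 2)) * (-(g s))) - β * G s) s :=
    ((hψc.neg.mul (hg.const_add (f r))).add (((hρ.const_mul β).const_add α).mul (hG.const_sub (F r)))).sub
      ((h𝔾.const_add (𝔽 r)).const_mul β)
  refine hx.congr_deriv ?_
  field_simp
  linear_combination (2 * g s) * hI1 - (F r + G s) * hI2

/-- `tanh' = 1 − tanh²` (Mathlib has `sinh`, `cosh`; the quotient rule). [folklore] -/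
theorem hasDerivAt_tanh_one_sub_sq (ρ : ℝ) : HasDerivAt Real.tanh (1 - Real.tanh ρ ^ 2) ρ := by
  have h := (Real.hasDerivAt_sinh ρ).div (Real.hasDerivAt_cosh ρ) (Real.cosh_pos ρ).ne'
  have hfun : Real.sinh / Real.cosh = Real.tanh :=
    funext fun x => by simp [Real.tanh_eq_sinh_div_cosh]
  rw [hfun] at h
  refine h.congr_deriv ?_
  have hc : Real.cosh ρ ≠ 0 := (Real.cosh_pos ρ).ne'
  have hsq := Real.cosh_sq ρ
  rw [Real.tanh_eq_sinh_div_cosh]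
  field_simp

/-- ★ **The Pöschl–Teller/Darboux pair.**  `T = tanh` and `ψ(ρ) = α tanh ρ + β(ρ tanh ρ − 1)` — the zero-energy solutions of
`ψ'' = −2 sech²ρ · ψ` — satisfy the two Darboux identities (I1) `ψT + ψ' = α + βρ` and (I2) `ψT' − ψ'T = −β` used by
`hodograph_r` / `hodograph_s`, with `T' = 1 − tanh²ρ` and `ψ' = α(1 − tanh²ρ) + β(tanh ρ + ρ(1 − tanh²ρ))`.  Hence for EVERY choice of
profiles the displayed pair solves the hodograph system of the p-system with speed `k = ψ²`. [folklore] -/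
theorem darboux_tanh (α β ρ : ℝ) :
    HasDerivAt Real.tanh (1 - Real.tanh ρ ^ 2) ρ ∧
      HasDerivAt (fun t => α * Real.tanh t + β * (t * Real.tanh t - 1))
        (α * (1 - Real.tanh ρ ^ 2) + β * (Real.tanh ρ + ρ * (1 - Real.tanh ρ ^ 2))) ρ ∧
      (α * Real.tanh ρ + β * (ρ * Real.tanh ρ - 1)) * Real.tanh ρ +
          (α * (1 - Real.tanh ρ ^ 2) + β * (Real.tanh ρ + ρ * (1 - Real.tanh ρ ^ 2))) = α + β * ρ ∧
      (α * Real.tanh ρ + β * (ρ * Real.tanh ρ - 1)) * (1 - Real.tanh ρ ^ 2) -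
          (α * (1 - Real.tanh ρ ^ 2) + β * (Real.tanh ρ + ρ * (1 - Real.tanh ρ ^ 2))) * Real.tanh ρ = -β := by
  have hT := hasDerivAt_tanh_one_sub_sq ρ
  refine ⟨hT, ?_, by ring, by ring⟩
  have h1 : HasDerivAt (fun t => t * Real.tanh t) (1 * Real.tanh ρ + ρ * (1 - Real.tanh ρ ^ 2)) ρ :=
    (hasDerivAt_id ρ).mul hT
  have h2 := (hT.const_mul α).add ((h1.sub_const 1).const_mul β)
  refine h2.congr_deriv ?_
  ring

/-- **The hump.**  For `α = 0`, `β = −1` the Darboux function is `ψ(ρ) = 1 − ρ tanh ρ`, positive on `|ρ| ≤ 1`, and its derivative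
`ψ'(ρ) = −(tanh ρ + ρ(1 − tanh²ρ))` is positive for `−1 ≤ ρ < 0` and negative for `0 < ρ ≤ 1`: the characteristic speed `k = ψ²`
INCREASES then DECREASES through the value `ρ = 0` — genuine nonlinearity with exactly one inflection value and no interval of
linear degeneracy (the row «(β)» of the crux census). [folklore] -/
theorem hump_speed_sign (ρ : ℝ) (hρ : |ρ| ≤ 1) :
    0 < 1 - ρ * Real.tanh ρ ∧
      (ρ < 0 → 0 < -(Real.tanh ρ + ρ * (1 - Real.tanh ρ ^ 2))) ∧
      (0 < ρ → -(Real.tanh ρ + ρ * (1 - Real.tanh ρ ^ 2)) < 0) := by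
  have hlt : Real.tanh ρ ^ 2 < 1 := by
    have h1 : |Real.tanh ρ| < 1 := by
      rw [abs_lt]; exact ⟨Real.neg_one_lt_tanh ρ, Real.tanh_lt_one ρ⟩
    have : |Real.tanh ρ| ^ 2 < 1 ^ 2 := by
      exact pow_lt_pow_left₀ h1 (abs_nonneg _) two_ne_zero
    simpa [sq_abs] using this
  -- sign of tanh
  have hpos : ∀ t : ℝ, 0 < t → 0 < Real.tanh t := fun t ht => by
    rw [Real.tanh_eq_sinh_div_cosh]
    exact div_pos (Real.sinh_pos_iff.mpr ht) (Real.cosh_pos t)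
  have hneg : ∀ t : ℝ, t < 0 → Real.tanh t < 0 := fun t ht => by
    have := hpos (-t) (by linarith)
    rw [Real.tanh_neg] at this
    linarith
  refine ⟨?_, ?_, ?_⟩
  · -- `ρ tanh ρ ≤ |ρ| |tanh ρ| < |ρ| ≤ 1` unless `ρ = 0`
    rcases lt_trichotomy ρ 0 with h | h | h
    · have ht := hneg ρ h
      have hρ' : -1 ≤ ρ := by rw [abs_le] at hρ; exact hρ.1
      have htl : -1 < Real.tanh ρ := Real.neg_one_lt_tanh ρ
      nlinarith
    · subst h; simp
    · have ht := hpos ρ h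
      have hρ' : ρ ≤ 1 := by rw [abs_le] at hρ; exact hρ.2
      have htl : Real.tanh ρ < 1 := Real.tanh_lt_one ρ
      nlinarith
  · intro h
    have ht := hneg ρ h
    nlinarith
  · intro h
    have ht := hpos ρ h
    nlinarith

end Summit.NavierStokesRegularity.NavierStokesRegularity.Theorems.PoloidalWindowDoorPoloidalWindowRigidityZShockHodographDarboux
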